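import Summits.AtomisticToContinuum.HydrodynamicLimit.Theorems.CollisionIsometryCLTDiffuseBackwardInfluenceOnePathScores
import HarnessLib

/-!
# `DiffuseBackwardInfluence`, line `share-nondegeneracy-one-flight`, skeleton v7: vocabulary of the PAIR-PATH reshape
(stmt-AtomisticToContinuum-12950; `--supports` definitions file of the continuation lead c6)

The v3–v6 two-body stub `stub_lateTouchRare` (late host–host contacts of the two influence tracers are rare) is TRUE but
circular as a decomposition (crux NOTES.md §3/§7/§11(b): as cut it is the crux functional summed over the late window, i.e.
the crux with a rate). Skeleton v7 replaces {`OnePathBound`, `LateMergesRareAt`} by the RENEWAL decomposition of the pair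
process of the two tracers of one source, whose inputs are honest (none contains the crux, none needs a rate):

* `PairPathBound σ` (PATHWISE, provable — stub `stub_pairPathBound`): for every configuration and window, if every slot of
  the `2mL`-grid has `idleFr + degFr ≤ b`, then
  `ipr ≤ 9 (2^{j₀} (1 − η(1 − η))^{mL} + totalRemFr / j₀ + 2 b + 2 crossRemFr_{2mL})`
  (marked full pair process: splits `s`, scores `t`, slot tag `g`; the geometric supermartingale `Σ 2^{-s} ρ₁^{-t} mass`,
  the split moment `Σ s·(together mass) ≤ total merge mass`, and the score deficit paid by idle/degenerate charges and by
  re-merges across a slot boundary; design in `Cruxes/DiffuseBackwardInfluence/Lines/share-nondegeneracy-one-flight` notes);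
* `RemergeBoundedAt` (CONJECTURE-level input, along the local-Gibbs-evolved law): the expected total merge mass of the two
  tracers of a uniform source over the window stays BOUNDED (`∃ M`) — defective renewal: after a split the pair re-merges with
  probability `≤ r < 1`, so the number of together-episodes is geometric, uniformly in the window length;
* `CrossRemergeRareAt` (CONJECTURE-level input): for every FIXED grid, re-merges of pairs that were already apart at the start
  of the current slot have vanishing expected mass — pair transience of the two hosts over the `n_N / S → ∞` collisions of a slot;
* `CrossRemMeasurable σ` (technical, provable — stub `stub_crossRemMeasurable`): measurability of `y ↦ crossRemFr`, so that the
  two expectations add (`lintegral_add_right`).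
The lever `ShareLD.NearSetLD` (⇒ `ShareLDAt`), `FewIdleSuperExpAt` (landed via `StickLD`), `RowBudgetN` and `EntropyTransferAt`
are consumed unchanged.

This file is DEFINITIONS + STATEMENTS only (nothing is asserted): §1 the one-tracer hop kernel `hopKernel` of a fold step and the
canonical functionals `apartFrom` (pairs apart since a slot start, no inflow), `crossRemAt`, `crossRemFr`, `totalRemFr`; §2 the
statements; §3 (namespace `PairPath`) the proof devices of `stub_pairPathBound` over the one-source data `OnePath.Src`: started-slot
counter `cnt`, gap counter `gap`, score increment `dlt`, the generic marked one-event maps `kstep`/`stepT`/`stepA` and the marked pair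
process `proc`/`Tm`/`Am`, with their unfolding lemmas.
-/

namespace Summit.AtomisticToContinuum.HydrodynamicLimit.Theorems.DiffuseBackwardInfluenceShare

open scoped BigOperators Topology ENNReal InnerProductSpace Classical
open Filter Set MeasureTheory
open Literature.Analysis.FluidPDE (Config HardSphereFlow collidePair)
open Literature.MathematicalPhysics.KineticTheory (localGibbsLaw hsDiameter)
open Summit.AtomisticToContinuum.HydrodynamicLimit.Theorems.DiffuseBackwardInfluenceNeg

noncomputable section

/-! ## §1 The hop kernel and the canonical two-tracer functionals -/

section Canonical

variable (σ : ℝ) (N : ℕ)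

/-- The one-tracer HOP KERNEL of source `src` at fold step `n`: the probability that an influence tracer of `src` sitting on
particle `i'` before the step sits on `i` after it — at the reflected pair `(p, q)` a tracer on `p` hops to `q` with the
handed-over fraction `shareFrac p` (and symmetrically), every other particle keeps its tracers; the identity if the step
reflects nothing. The tracer law `μ(i) = a_{i,src}/3` is transported by it (`OnePath.mu_succ_eq_ite`). -/
def hopKernel (y : Cfg N) (src : Fin (N + 1)) (n : ℕ) (i' i : Fin (N + 1)) : ℝ :=
  if h : (pairsAt σ N y n).Nonempty then
    if i' = h.some.1 then
      (if i = h.some.1 then 1 - shareFrac σ N y n h.some.1 src (unitNormal σ N y n)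
        else if i = h.some.2 then shareFrac σ N y n h.some.1 src (unitNormal σ N y n) else 0)
    else if i' = h.some.2 then
      (if i = h.some.2 then 1 - shareFrac σ N y n h.some.2 src (unitNormal σ N y n)
        else if i = h.some.1 then shareFrac σ N y n h.some.2 src (unitNormal σ N y n) else 0)
    else if i = i' then 1 else 0
  else if i = i' then 1 else 0

/-- PAIRS APART SINCE A SLOT START: `apartFrom y src Δ S r t i j` is the probability that two conditionally independent
tracers of `src` sit on `(i, j)`, `i ≠ j`, at the fold step `slotStart r + t` AND have sat on different particles at every
fold step since the start of slot `r` (at `t = 0`: the product of the tracer laws off the diagonal; afterwards transported by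
the product kernel with the diagonal — re-merged pairs — removed and no inflow). -/
def apartFrom (y : Cfg N) (src : Fin (N + 1)) (Δ : ℝ) (S r : ℕ) : ℕ → Fin (N + 1) → Fin (N + 1) → ℝ
  | 0 => fun i j => if i = j then 0 else
      blockMass σ N y (slotStart σ N y Δ S r) i src / 3 * (blockMass σ N y (slotStart σ N y Δ S r) j src / 3)
  | t + 1 => fun i j => if i = j then 0 else
      ∑ i' : Fin (N + 1), ∑ j' : Fin (N + 1), apartFrom y src Δ S r t i' j' *
        (hopKernel σ N y src (slotStart σ N y Δ S r + t) i' i * hopKernel σ N y src (slotStart σ N y Δ S r + t) j' j)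

/-- CROSS-SLOT RE-MERGE MASS at the `t`-th step of slot `r`: the probability that the two tracers of `src`, apart since the
start of slot `r`, re-merge at fold step `slotStart r + t`. -/
def crossRemAt (y : Cfg N) (src : Fin (N + 1)) (Δ : ℝ) (S r t : ℕ) : ℝ :=
  ∑ i : Fin (N + 1), ∑ i' : Fin (N + 1), ∑ j' : Fin (N + 1), apartFrom σ N y src Δ S r t i' j' *
    (hopKernel σ N y src (slotStart σ N y Δ S r + t) i' i * hopKernel σ N y src (slotStart σ N y Δ S r + t) j' i)

/-- CROSS-SLOT RE-MERGE FRACTION of the window on the grid with `S` slots: the source average of the total mass of re-merges,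
during each slot, of tracer pairs that were already apart when that slot started (the DELAYED re-merges; the only two-body
quantity of v7 that must tend to `0`). -/
def crossRemFr (y : Cfg N) (Δ : ℝ) (S : ℕ) : ℝ :=
  ((N + 1 : ℕ) : ℝ)⁻¹ * ∑ src : Fin (N + 1), ∑ r ∈ Finset.range S,
    ∑ t ∈ Finset.range (slotStart σ N y Δ S (r + 1) - slotStart σ N y Δ S r), crossRemAt σ N y src Δ S r t

/-- TOTAL RE-MERGE FRACTION of the window: the source average of the merge mass `mergeAt` summed over ALL fold steps of the
window (the expected number of re-merges of the two tracers of a uniform source; v7 only needs it BOUNDED). -/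
def totalRemFr (y : Cfg N) (Δ : ℝ) : ℝ :=
  ((N + 1 : ℕ) : ℝ)⁻¹ * ∑ src : Fin (N + 1), ∑ c ∈ Finset.range (colls σ N y Δ), mergeAt σ N y src c

end Canonical

/-! ## §2 The statements of skeleton v7 -/

/-- THE PAIR-PATH BOUND, PATHWISE (renewal form of the one-path bound; no measure theory): for every configuration `y`,
window `Δ > 0`, `η ∈ (0,1)`, `m, L, j₀ ≥ 1` and level `b`, if on each of the `2mL` slots the idle fraction plus the
share-degeneracy score is `≤ b`, then
`ipr ≤ 9 · (2^{j₀} (1 − η(1−η))^{mL} + totalRemFr / j₀ + 2 b + 2 · crossRemFr_{2mL})`.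
Content: `ipr/9` is the source average of the together-mass of two conditionally independent tracers; mark the full pair process
by the number `s` of splits, the number `t` of scores (first-in-slot non-degenerate collisions of the common host) and the slot
tag of the current separation; `Σ 2^{-s}(1 − η(1−η))^{-t}·mass` is non-increasing; `Σ s·(together mass) ≤` total merge mass
(`totalRemFr`, Markov in `s ≥ j₀`); the score deficit `S − t` of together mass is paid by idle/degenerate first collisions of its
hosts (`Σ_r idleFr_r + degFr_r ≤ 2mL·b`, Markov at `S/2 = mL`) and by re-merges across a slot boundary (`≤ S · crossRemFr`). -/
def PairPathBound (σ : ℝ) : Prop :=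
  ∀ (N : ℕ) (y : Cfg N) (Δ : ℝ), 0 < Δ → ∀ η : ℝ, 0 < η → η < 1 →
    ∀ m L j₀ : ℕ, 1 ≤ m → 1 ≤ L → 1 ≤ j₀ → ∀ b : ℝ,
      (∀ r : ℕ, r < 2 * m * L → idleFr σ N y Δ (2 * m * L) r + degFr σ N y Δ (2 * m * L) r η ≤ b) →
      ipr σ N y Δ ≤ 9 * ((2 : ℝ) ^ j₀ * (1 - η * (1 - η)) ^ (m * L) + totalRemFr σ N y Δ / (j₀ : ℝ) + 2 * b +
        2 * crossRemFr σ N y Δ (2 * m * L))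

/-- RE-MERGES ARE BOUNDED IN MEAN (two-body input 1 of v7, along the local-Gibbs-EVOLVED law): for every admissible window and
`t > 0` there is `M` such that eventually the expected total re-merge fraction of the window is `≤ M`. Heuristic: a split pair
re-merges with probability `≤ r < 1` uniformly (prompt ring re-collision `≍ σ³` plus a transient tail), so the number of
together-episodes of the two tracers is stochastically geometric whatever the number `n_N → ∞` of collisions per particle;
`M ≈ r/(1−r)`. Does not contain the crux (degenerate normals give no splits and `totalRemFr = 0`). -/
def RemergeBoundedAt (σ : ℝ) (a₀ θ₀ : T3 → ℝ) (u₀ : T3 → V3) (Φ : (N : ℕ) → Flow σ N) : Prop :=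
  ∀ Δ : ℕ → ℝ, (∀ N, 0 < Δ N) → Tendsto Δ atTop (𝓝 0) →
    Tendsto (fun N : ℕ => Δ N * ((N + 1 : ℕ) : ℝ) ^ ((1 : ℝ) / 3)) atTop atTop →
    ∀ t : ℝ, 0 < t → ∃ M : ℝ, 0 ≤ M ∧
      ∀ᶠ N : ℕ in atTop,
        ∫⁻ z, ENNReal.ofReal (totalRemFr σ N ((Φ N).flow (t - Δ N) z) (Δ N))
            ∂(localGibbsLaw σ a₀ u₀ θ₀ N (Φ N)) ≤ ENNReal.ofReal M

/-- CROSS-SLOT RE-MERGES ARE RARE (two-body input 2 of v7, along the local-Gibbs-EVOLVED law): for every admissible window,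
`t > 0`, every FIXED grid size `S ≥ 1` and `ε > 0`, eventually the expected cross-slot re-merge fraction is `≤ ε`. Heuristic: a
pair that is apart at a slot boundary has, typically, `≍ n_N/S → ∞` further host collisions before the slot ends... and, more to
the point, re-merges after the two hosts have parted for `≫ 1` collisions are governed by pair transience in `d = 3` (fresh
re-encounter intensity `≍ σ⁶ j^{−3/2}` at lag `j`, summable), while separations that straddle a boundary within `O(1)` collisions
have probability `O(S/n_N) → 0`; the number of separations is `O(1)` in mean (input 1). Does not contain the crux. -/
def CrossRemergeRareAt (σ : ℝ) (a₀ θ₀ : T3 → ℝ) (u₀ : T3 → V3) (Φ : (N : ℕ) → Flow σ N) : Prop :=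
  ∀ Δ : ℕ → ℝ, (∀ N, 0 < Δ N) → Tendsto Δ atTop (𝓝 0) →
    Tendsto (fun N : ℕ => Δ N * ((N + 1 : ℕ) : ℝ) ^ ((1 : ℝ) / 3)) atTop atTop →
    ∀ t : ℝ, 0 < t → ∀ S : ℕ, 1 ≤ S → ∀ ε : ℝ, 0 < ε →
      ∀ᶠ N : ℕ in atTop,
        ∫⁻ z, ENNReal.ofReal (crossRemFr σ N ((Φ N).flow (t - Δ N) z) (Δ N) S)
            ∂(localGibbsLaw σ a₀ u₀ θ₀ N (Φ N)) ≤ ENNReal.ofReal ε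

/-- MEASURABILITY of the cross-slot re-merge fraction in the configuration (technical input of the v7 composition: it makes the
expectation of `totalRemFr/j₀ + 2·crossRemFr` split into the two hypotheses above). Provable from the measurability of the
Alexander construction (`Literature.Analysis.FluidPDE.HardSphereFlowMeasurable`), the reflected pair being a function of the
finitely-valued measurable map `y ↦ pairsAt y n`. -/
def CrossRemMeasurable (σ : ℝ) : Prop :=
  ∀ (N : ℕ) (Δ : ℝ) (S : ℕ), Measurable fun y : Cfg N => crossRemFr σ N y Δ S

namespace PairPath

/-- **RE-MERGES ARE BOUNDED IN MEAN** for every nice profile, below a density threshold `σ₀(profiles)`, for every flow family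
(the form the v7 composition consumes; conjecture-level two-body input 1, see `RemergeBoundedAt`). Not in the tree or in print. -/
@[conjecture] def RemergeBounded : Prop :=
  ∀ (a₀ θ₀ : T3 → ℝ) (u₀ : T3 → V3), Continuous a₀ → Continuous θ₀ → Continuous u₀ →
    (∀ x, 0 < a₀ x) → (∀ x, 0 < θ₀ x) → ∃ σ₀ : ℝ, 0 < σ₀ ∧ ∀ σ : ℝ, 0 < σ → σ < σ₀ →
      ∀ Φ : (N : ℕ) → Flow σ N, RemergeBoundedAt σ a₀ θ₀ u₀ Φ

/-- **CROSS-SLOT RE-MERGES ARE RARE** for every nice profile, below a density threshold `σ₀(profiles)`, for every flow family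
(conjecture-level two-body input 2, see `CrossRemergeRareAt`). Not in the tree or in print. -/
@[conjecture] def CrossRemergeRare : Prop :=
  ∀ (a₀ θ₀ : T3 → ℝ) (u₀ : T3 → V3), Continuous a₀ → Continuous θ₀ → Continuous u₀ →
    (∀ x, 0 < a₀ x) → (∀ x, 0 < θ₀ x) → ∃ σ₀ : ℝ, 0 < σ₀ ∧ ∀ σ : ℝ, 0 < σ → σ < σ₀ →
      ∀ Φ : (N : ℕ) → Flow σ N, CrossRemergeRareAt σ a₀ θ₀ u₀ Φ

/-! ## §3 Proof devices of `stub_pairPathBound`: the marked pair process of one source -/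

/-! ### Generic one-event maps on marked profiles -/

section Generic

variable {ι : Type*} [DecidableEq ι] [Fintype ι]

/-- The one-tracer kernel of an exchange event at the pair `(p, q)` with handed-over fractions `f`. -/
def kstep (p q : ι) (f : ι → ℝ) (i' i : ι) : ℝ :=
  if i' = p then (if i = p then 1 - f p else if i = q then f p else 0)
  else if i' = q then (if i = q then 1 - f q else if i = p then f q else 0)
  else if i = i' then 1 else 0

/-- One exchange event on the TOGETHER profile `T i s t` (mass of tracer pairs sitting together on `i` with `s` splits and `t`
scores), given the APART profile `A i j s t g`: pairs on an untouched particle stay; pairs on a host `h ∈ {p, q}` first score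
(`t ↦ t + δ h`), then both tracers move with the kernel (both to the same particle: factor `kstep h i ^ 2`); apart pairs whose
two tracers land on the same particle re-merge, keeping their marks `(s, t)`. -/
def stepT (p q : ι) (f : ι → ℝ) (δ : ι → ℕ) (G : ℕ) (T : ι → ℕ → ℕ → ℝ) (A : ι → ι → ℕ → ℕ → ℕ → ℝ) :
    ι → ℕ → ℕ → ℝ :=
  fun i s t =>
    (if i = p ∨ i = q then 0 else T i s t)
    + (if δ p ≤ t then kstep p q f p i ^ 2 * T p s (t - δ p) else 0)
    + (if δ q ≤ t then kstep p q f q i ^ 2 * T q s (t - δ q) else 0)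
    + ∑ i', ∑ j', ∑ g ∈ Finset.range (G + 1), A i' j' s t g * (kstep p q f i' i * kstep p q f j' i)

/-- One exchange event on the APART profile `A i j s t g` (mass of tracer pairs on `(i, j)`, `i ≠ j`, with `s` splits, `t`
scores, current separation tagged `g`): apart pairs move by the product kernel (those landing on the diagonal leave — they are the
re-merges of `stepT`); together pairs on a host `h ∈ {p, q}` that split (one tracer hops, the other stays) arrive with `s + 1`
splits, the scored `t`, and the tag `c₀` of the current slot count. -/
def stepA (p q : ι) (f : ι → ℝ) (δ : ι → ℕ) (c₀ : ℕ) (T : ι → ℕ → ℕ → ℝ) (A : ι → ι → ℕ → ℕ → ℕ → ℝ) :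
    ι → ι → ℕ → ℕ → ℕ → ℝ :=
  fun i j s t g =>
    if i = j then 0 else
      (∑ i', ∑ j', A i' j' s t g * (kstep p q f i' i * kstep p q f j' j))
      + (if g = c₀ ∧ 1 ≤ s then
          (if δ p ≤ t then T p (s - 1) (t - δ p) * (kstep p q f p i * kstep p q f p j) else 0)
          + (if δ q ≤ t then T q (s - 1) (t - δ q) * (kstep p q f q i * kstep p q f q j) else 0)
        else 0)

end Generic

/-! ### The marked pair process of one source -/

section Process

variable {N : ℕ} (C : OnePath.Src N)

/-- The grid size `S = 2mL`. -/
def S : ℕ := 2 * C.m * C.L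

/-- The number of slots of the grid STARTED by fold step `n` (`#{r < S : slotStart r ≤ n}`). -/
def cnt (n : ℕ) : ℕ := ((Finset.range (S C)).filter fun r => OnePath.nS C r ≤ n).card

/-- The GAP of particle `i` at fold step `n`: the number of started slots since whose start `i` has not been touched before `n`
(the slots whose score for a pair sitting together on `i` is still unresolved). -/
def gap (n : ℕ) (i : Fin (N + 1)) : ℕ :=
  ((Finset.range (S C)).filter fun r =>
    OnePath.nS C r ≤ n ∧ ∀ c, OnePath.nS C r ≤ c → c < n → ¬ Touches C.σ N C.y c i).card

/-- The SCORE INCREMENT of particle `i` at fold step `n`: `1` if `n` is the first collision of `i` in the current slot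
(`gap ≥ 1`) and that collision is `η`-non-degenerate for the block `(i, source)` (`i ∈ OnePath.Good (cnt n − 1)`), else `0`. -/
def dlt (n : ℕ) (i : Fin (N + 1)) : ℕ :=
  if 1 ≤ gap C n i ∧ i ∈ OnePath.Good C (cnt C n - 1) then 1 else 0

/-- The hop kernel of the source at fold step `n`. -/
def K (n : ℕ) (i' i : Fin (N + 1)) : ℝ := hopKernel C.σ N C.y C.k n i' i

/-- THE MARKED PAIR PROCESS (together profile, apart profile) after `n` fold steps, by primitive recursion along the fold:
initially both tracers sit on the source with no split and no score. -/
def proc : ℕ → (Fin (N + 1) → ℕ → ℕ → ℝ) × (Fin (N + 1) → Fin (N + 1) → ℕ → ℕ → ℕ → ℝ)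
  | 0 => (fun i s t => if i = C.k ∧ s = 0 ∧ t = 0 then 1 else 0, fun _ _ _ _ _ => 0)
  | n + 1 =>
    if h : (pairsAt C.σ N C.y n).Nonempty then
      (stepT h.some.1 h.some.2 (OnePath.fr C n) (dlt C n) (S C) (proc n).1 (proc n).2,
        stepA h.some.1 h.some.2 (OnePath.fr C n) (dlt C n) (cnt C n) (proc n).1 (proc n).2)
    else proc n

/-- The together profile after `n` fold steps. -/
def Tm (n : ℕ) : Fin (N + 1) → ℕ → ℕ → ℝ := (proc C n).1

/-- The apart profile after `n` fold steps. -/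
def Am (n : ℕ) : Fin (N + 1) → Fin (N + 1) → ℕ → ℕ → ℕ → ℝ := (proc C n).2

variable {C}

/-- `Tm` at time `0`. -/
theorem Tm_zero (i : Fin (N + 1)) (s t : ℕ) : Tm C 0 i s t = if i = C.k ∧ s = 0 ∧ t = 0 then 1 else 0 := rfl

/-- `Am` at time `0`. -/
theorem Am_zero (i j : Fin (N + 1)) (s t g : ℕ) : Am C 0 i j s t g = 0 := rfl

/-- `Tm` after a reflecting step. -/
theorem Tm_succ_of {n : ℕ} (h : (pairsAt C.σ N C.y n).Nonempty) :
    Tm C (n + 1) = stepT h.some.1 h.some.2 (OnePath.fr C n) (dlt C n) (S C) (Tm C n) (Am C n) := by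
  simp only [Tm, Am, proc, dif_pos h]

/-- `Am` after a reflecting step. -/
theorem Am_succ_of {n : ℕ} (h : (pairsAt C.σ N C.y n).Nonempty) :
    Am C (n + 1) = stepA h.some.1 h.some.2 (OnePath.fr C n) (dlt C n) (cnt C n) (Tm C n) (Am C n) := by
  simp only [Tm, Am, proc, dif_pos h]

/-- `Tm` after an idle step. -/
theorem Tm_succ_of_not {n : ℕ} (h : ¬ (pairsAt C.σ N C.y n).Nonempty) : Tm C (n + 1) = Tm C n := by
  simp only [Tm, proc, dif_neg h]

/-- `Am` after an idle step. -/
theorem Am_succ_of_not {n : ℕ} (h : ¬ (pairsAt C.σ N C.y n).Nonempty) : Am C (n + 1) = Am C n := by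
  simp only [Am, proc, dif_neg h]

/-- The source's hop kernel is the generic kernel of the reflected pair with the source's fractions. -/
theorem K_eq_kstep_of {n : ℕ} (h : (pairsAt C.σ N C.y n).Nonempty) (i' i : Fin (N + 1)) :
    K C n i' i = kstep h.some.1 h.some.2 (OnePath.fr C n) i' i := by
  simp only [K, hopKernel, dif_pos h, kstep, OnePath.fr]

/-- At an idle step the hop kernel is the identity. -/
theorem K_of_not {n : ℕ} (h : ¬ (pairsAt C.σ N C.y n).Nonempty) (i' i : Fin (N + 1)) :
    K C n i' i = if i = i' then 1 else 0 := by
  simp only [K, hopKernel, dif_neg h]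

end Process

end PairPath

/-- Dictionary (registered sub-goal `pairPath_totalRemFr_eq` of the crux item): the total re-merge fraction is the source
average of the landed merge mass `mergeAt` summed over all fold steps of the window (definitional). -/
theorem pairPath_totalRemFr_eq : ∀ (σ : ℝ) (N : ℕ) (y : Cfg N) (Δ : ℝ), totalRemFr σ N y Δ = ((N + 1 : ℕ) : ℝ)⁻¹ * ∑ src : Fin (N + 1), ∑ c ∈ Finset.range (colls σ N y Δ), mergeAt σ N y src c :=
  fun _ _ _ _ => rfl

end

end Summit.AtomisticToContinuum.HydrodynamicLimit.Theorems.DiffuseBackwardInfluenceShare
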